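import Summits.Ventures.Crystal3D.Theorems.StickyWulffConstantPolycrystalWulffBoundRungGapTree
import Summits.Ventures.Crystal3D.Theorems.StickyWulffConstantPolycrystalWulffBoundMinkowskiFacetSlab

/-!
# `PolycrystalWulffBound`, line `PolyDensity`: the ALL-PAIRS gap-sorted chimera (helpers for
# `rung_gapCells`; crux `stmt-Ventures-19482`)

Route `StickyWulffConstant` of the venture `Summits/Ventures/Crystal3D`, second prover lane (poly-p2,
gen 14).  Two helpers of the reduction rung `rung_gapCells` (…RungGapCells.lean):
* `volume_sepSlab_le` — the thin slab of a bounded open `H`-polytope `Q ⊆ {⟪ν, x⟫ < β}` under ANY of its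
  separating planes has volume `≤ s·(facetArea(cl Q ∩ {⟪ν,x⟫ = β}) + ε)` for small `s` (insert the plane
  into the `H`-representation and use `volume_facetSlab_le`); the area is `0` when the plane meets `cl Q`
  in an edge or a vertex — junction lines are free;
* `gapCells_chimera_lower` — cells trimmed by `r·t j j'` along every separating plane, targets
  `W(A_j) ∩ ⋂_{j'} {⟪y, nv j j'⟫ ≤ τ j j'}` with `τ j j' + τ j' j ≤ t j j' + t j' j`: the swollen pieces
  are pairwise disjoint, hence `piecewise_chimera_lower` applies.
WHAT THIS IS NOT: the rung; the crux is not claimed.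
-/

noncomputable section

open scoped BigOperators InnerProductSpace ENNReal Pointwise
open MeasureTheory Set

namespace Summit.Ventures.Crystal3D.Theorems

open Summit.Ventures.Crystal3D.Cruxes.TextureLiminf.TexShadow (E3 polytope facetArea)
open Literature.MathematicalPhysics.StatisticalMechanics (fccStacking)

/-- **Thin slabs under a separating plane.**  `Q` a bounded open `H`-polytope with unit normals,
`Q ⊆ {⟪ν, x⟫ < β}` with `‖ν‖ = 1`: for every `ε > 0` there is `δ > 0` with
`|Q ∩ {β − s < ⟪ν, x⟫}| ≤ s·(facetArea (cl Q ∩ {⟪ν, x⟫ = β}) ν + ε)` for `0 < s < δ`. -/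
theorem volume_sepSlab_le (H : Finset (E3 × ℝ))
    (hbd : Bornology.IsBounded (⋂ q ∈ H, {x : E3 | ⟪q.1, x⟫_ℝ < q.2}))
    (hunit : ∀ q ∈ H, ‖q.1‖ = 1) {ν : E3} (hν : ‖ν‖ = 1) {β : ℝ}
    (hsep : (⋂ q ∈ H, {x : E3 | ⟪q.1, x⟫_ℝ < q.2}) ⊆ {x : E3 | ⟪ν, x⟫_ℝ < β}) {ε : ℝ} (hε : 0 < ε) :
    ∃ δ : ℝ, 0 < δ ∧ ∀ s : ℝ, 0 < s → s < δ →
      (volume ((⋂ q ∈ H, {x : E3 | ⟪q.1, x⟫_ℝ < q.2}) ∩ {x : E3 | β - s < ⟪ν, x⟫_ℝ})).toReal ≤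
        s * (facetArea (closure (⋂ q ∈ H, {x : E3 | ⟪q.1, x⟫_ℝ < q.2}) ∩ {x : E3 | ⟪ν, x⟫_ℝ = β}) ν
          + ε) := by
  classical
  set Q : Set E3 := ⋂ q ∈ H, {x : E3 | ⟪q.1, x⟫_ℝ < q.2} with hQ
  by_cases hne : Q.Nonempty
  · set H' : Finset (E3 × ℝ) := insert (ν, β) H with hH'
    have hQ' : (⋂ q ∈ H', {x : E3 | ⟪q.1, x⟫_ℝ < q.2}) = Q := by
      ext x
      simp only [hH', Finset.set_biInter_insert, mem_inter_iff, mem_setOf_eq]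
      constructor
      · rintro ⟨-, h⟩; exact h
      · intro h; exact ⟨hsep h, h⟩
    have hbd' : Bornology.IsBounded (⋂ q ∈ H', {x : E3 | ⟪q.1, x⟫_ℝ < q.2}) := by rw [hQ']; exact hbd
    have hne' : (⋂ q ∈ H', {x : E3 | ⟪q.1, x⟫_ℝ < q.2}).Nonempty := by rw [hQ']; exact hne
    have hunit' : ∀ q ∈ H', ‖q.1‖ = 1 := by
      intro q hq
      rw [hH', Finset.mem_insert] at hq
      rcases hq with rfl | hq
      · exact hν
      · exact hunit q hq
    have hq₀ : (ν, β) ∈ H' := by rw [hH']; exact Finset.mem_insert_self _ _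
    obtain ⟨δ, hδ, h⟩ := volume_facetSlab_le H' hbd' hne' hunit' hq₀ hε
    refine ⟨δ, hδ, fun s hs hsδ => ?_⟩
    have h' := h s hs hsδ
    rw [hQ'] at h'
    exact h'
  · refine ⟨1, one_pos, fun s hs _ => ?_⟩
    rw [Set.not_nonempty_iff_eq_empty] at hne
    rw [hne, Set.empty_inter, measure_empty, ENNReal.toReal_zero]
    exact mul_nonneg hs.le (add_nonneg ENNReal.toReal_nonneg hε.le)

/-- **All-pairs gap-sorted chimera lower bound.**  Open cells `Q_j` separated pairwise by the planes
`{⟪nv j j', x⟫ = b j j'}` (`nv`, `b` antisymmetric), trim depths `t`, thresholds `τ` with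
`τ j j' + τ j' j ≤ t j j' + t j' j`; trimmed cells `Q'_j = Q_j ∩ ⋂_{j' ≠ j} {⟪nv j j', x⟫ < b j j' − r t j j'}`
and targets `T_j = W(A_j) ∩ ⋂_{j' ≠ j} {⟪y, nv j j'⟫ ≤ τ j j'}` with `|T_j| ≥ κ|Q'_j|/|⋃ Q'|`.  Then
`|⋃ Q'|^{1/3} + r·κ^{1/3} ≤ |U|^{1/3}` for every `U` containing all `x + r·w`, `x ∈ Q_j`, `w ∈ W(A_j)`. -/
theorem gapCells_chimera_lower {k : ℕ} (Q : Fin k → Set E3) (A : Fin k → (E3 ≃ₗᵢ[ℝ] E3))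
    (nv : Fin k → Fin k → E3) (b τ t : Fin k → Fin k → ℝ) (hQo : ∀ j, IsOpen (Q j))
    (hanti : ∀ i j, nv j i = -nv i j) (hbanti : ∀ i j, b j i = -b i j)
    (hsep : ∀ j j', j ≠ j' → Q j ⊆ {x : E3 | ⟪nv j j', x⟫_ℝ < b j j'})
    (hgap : ∀ j j', j ≠ j' → τ j j' + τ j' j ≤ t j j' + t j' j) {r κ : ℝ} (hr : 0 < r) (hκ : 0 < κ)
    (h0 : volume (⋃ j, Q j ∩ {x : E3 | ∀ j', j' ≠ j → ⟪nv j j', x⟫_ℝ < b j j' - r * t j j'}) ≠ 0)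
    (htop : volume (⋃ j, Q j ∩ {x : E3 | ∀ j', j' ≠ j → ⟪nv j j', x⟫_ℝ < b j j' - r * t j j'}) ≠ ⊤)
    (hT : ∀ j, ENNReal.ofReal (κ * ((volume (Q j ∩ {x : E3 | ∀ j', j' ≠ j →
        ⟪nv j j', x⟫_ℝ < b j j' - r * t j j'})).toReal /
        (volume (⋃ j, Q j ∩ {x : E3 | ∀ j', j' ≠ j → ⟪nv j j', x⟫_ℝ < b j j' - r * t j j'})).toReal)) ≤
      volume ({y : E3 | ∀ ν : E3, ⟪y, ν⟫_ℝ ≤ Real.sqrt 2 / 4 *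
        ∑ᶠ w ∈ {w | w ∈ fccStacking 1 (Real.sqrt (2 / 3)) ∧ ‖w‖ = 1}, |⟪w, (A j).symm ν⟫_ℝ|} ∩
        ⋂ j' ∈ Finset.univ.filter (fun j' => j' ≠ j), {y : E3 | ⟪y, nv j j'⟫_ℝ ≤ τ j j'}))
    {U : Set E3}
    (hsub : ∀ j, ∀ x ∈ Q j, ∀ w ∈ {y : E3 | ∀ ν : E3, ⟪y, ν⟫_ℝ ≤ Real.sqrt 2 / 4 *
        ∑ᶠ w ∈ {w | w ∈ fccStacking 1 (Real.sqrt (2 / 3)) ∧ ‖w‖ = 1}, |⟪w, (A j).symm ν⟫_ℝ|},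
      x + r • w ∈ U) :
    volume (⋃ j, Q j ∩ {x : E3 | ∀ j', j' ≠ j → ⟪nv j j', x⟫_ℝ < b j j' - r * t j j'}) ^ ((3 : ℕ)⁻¹ : ℝ) +
        ENNReal.ofReal r * (ENNReal.ofReal κ) ^ ((3 : ℕ)⁻¹ : ℝ) ≤ volume U ^ ((3 : ℕ)⁻¹ : ℝ) := by
  classical
  set body : (E3 ≃ₗᵢ[ℝ] E3) → Set E3 := fun X => {y : E3 | ∀ ν : E3, ⟪y, ν⟫_ℝ ≤ Real.sqrt 2 / 4 *
    ∑ᶠ w ∈ {w | w ∈ fccStacking 1 (Real.sqrt (2 / 3)) ∧ ‖w‖ = 1}, |⟪w, X.symm ν⟫_ℝ|} with hbody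
  have hWm : ∀ X, MeasurableSet (body X) := fun X => (isCompact_cruxWulffBody X).isClosed.measurableSet
  set Q' : Fin k → Set E3 := fun j => Q j ∩ {x : E3 | ∀ j', j' ≠ j → ⟪nv j j', x⟫_ℝ < b j j' - r * t j j'}
    with hQ'
  have hQ'sub : ∀ j, Q' j ⊆ Q j := fun j => inter_subset_left
  have hQ'o : ∀ j, IsOpen (Q' j) := by
    intro j
    refine (hQo j).inter ?_
    have : {x : E3 | ∀ j', j' ≠ j → ⟪nv j j', x⟫_ℝ < b j j' - r * t j j'} =
        ⋂ j' : Fin k, {x : E3 | j' ≠ j → ⟪nv j j', x⟫_ℝ < b j j' - r * t j j'} := by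
      ext x; simp only [mem_setOf_eq, mem_iInter]
    rw [this]
    refine isOpen_iInter_of_finite fun j' => ?_
    by_cases hj : j' ≠ j
    · have : {x : E3 | j' ≠ j → ⟪nv j j', x⟫_ℝ < b j j' - r * t j j'} =
          {x : E3 | ⟪nv j j', x⟫_ℝ < b j j' - r * t j j'} := by
        ext x; simp only [mem_setOf_eq]; exact ⟨fun h => h hj, fun h _ => h⟩
      rw [this]
      exact isOpen_lt (continuous_const.inner continuous_id) continuous_const
    · have : {x : E3 | j' ≠ j → ⟪nv j j', x⟫_ℝ < b j j' - r * t j j'} = univ := by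
        ext x; simp only [mem_setOf_eq, mem_univ, iff_true]; exact fun h => absurd h hj
      rw [this]; exact isOpen_univ
  have hdisj : ∀ j j', j ≠ j' → Disjoint (Q j) (Q j') := by
    intro j j' hjj'
    rw [Set.disjoint_left]
    intro x hx hx'
    have h1 : ⟪nv j j', x⟫_ℝ < b j j' := hsep j j' hjj' hx
    have h2 : ⟪nv j' j, x⟫_ℝ < b j' j := hsep j' j (Ne.symm hjj') hx'
    rw [hanti j j', hbanti j j', inner_neg_left] at h2
    linarith
  have hdisj' : Pairwise fun j j' => Disjoint (Q' j) (Q' j') :=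
    fun j j' hjj' => (hdisj j j' hjj').mono (hQ'sub j) (hQ'sub j')
  -- the targets
  set T : Fin k → Set E3 := fun j => body (A j) ∩
    ⋂ j' ∈ Finset.univ.filter (fun j' => j' ≠ j), {y : E3 | ⟪y, nv j j'⟫_ℝ ≤ τ j j'} with hT'
  have hle_m : ∀ j j', MeasurableSet {y : E3 | ⟪y, nv j j'⟫_ℝ ≤ τ j j'} := fun j j' =>
    measurableSet_le (measurable_id.inner measurable_const) measurable_const
  have hTm : ∀ j, MeasurableSet (T j) := fun j =>
    (hWm (A j)).inter (Finset.measurableSet_biInter _ fun j' _ => hle_m j j')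
  have hmemT : ∀ j (y : E3), y ∈ (⋂ j' ∈ Finset.univ.filter (fun j' => j' ≠ j),
      {y : E3 | ⟪y, nv j j'⟫_ℝ ≤ τ j j'}) ↔ ∀ j', j' ≠ j → ⟪y, nv j j'⟫_ℝ ≤ τ j j' := by
    intro j y
    simp only [mem_iInter, Finset.mem_filter, Finset.mem_univ, true_and, mem_setOf_eq]
  -- disjointness of the swollen pieces: sorting along the separating planes
  have hdisjP : Pairwise fun j j' => Disjoint (Q' j + r • T j) (Q' j' + r • T j') := by
    intro j j' hjj'
    rw [Set.disjoint_left]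
    rintro z ⟨x, hx, y, hy, rfl⟩ ⟨x', hx', y', hy', hzz⟩
    obtain ⟨p, hp, rfl⟩ := Set.mem_smul_set.1 hy
    obtain ⟨p', hp', rfl⟩ := Set.mem_smul_set.1 hy'
    have hx1 : ⟪nv j j', x⟫_ℝ < b j j' - r * t j j' := hx.2 j' (Ne.symm hjj')
    have hx2 : ⟪nv j' j, x'⟫_ℝ < b j' j - r * t j' j := hx'.2 j hjj'
    have hp1 : ⟪p, nv j j'⟫_ℝ ≤ τ j j' := (hmemT j p).1 hp.2 j' (Ne.symm hjj')
    have hp2 : ⟪p', nv j' j⟫_ℝ ≤ τ j' j := (hmemT j' p').1 hp'.2 j hjj'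
    rw [hanti j j', inner_neg_left, hbanti j j'] at hx2
    rw [hanti j j', inner_neg_right] at hp2
    have hp1' : ⟪nv j j', p⟫_ℝ ≤ τ j j' := by rw [real_inner_comm]; exact hp1
    have hp2' : -τ j' j ≤ ⟪nv j j', p'⟫_ℝ := by rw [real_inner_comm]; linarith
    have hz1 : ⟪nv j j', x + r • p⟫_ℝ = ⟪nv j j', x⟫_ℝ + r * ⟪nv j j', p⟫_ℝ := by
      rw [inner_add_right, real_inner_smul_right]
    have hz2 : ⟪nv j j', x' + r • p'⟫_ℝ = ⟪nv j j', x'⟫_ℝ + r * ⟪nv j j', p'⟫_ℝ := by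
      rw [inner_add_right, real_inner_smul_right]
    have hzz' : x' + r • p' = x + r • p := hzz
    have heq : ⟪nv j j', x + r • p⟫_ℝ = ⟪nv j j', x' + r • p'⟫_ℝ := by rw [hzz']
    rw [hz1, hz2] at heq
    have hg := hgap j j' hjj'
    have h3 : r * ⟪nv j j', p⟫_ℝ ≤ r * τ j j' := mul_le_mul_of_nonneg_left hp1' hr.le
    have h4 : r * (-τ j' j) ≤ r * ⟪nv j j', p'⟫_ℝ := mul_le_mul_of_nonneg_left hp2' hr.le
    have h5 : r * (τ j j' + τ j' j) ≤ r * (t j j' + t j' j) := mul_le_mul_of_nonneg_left hg hr.le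
    linarith [hx1, hx2, h3, h4, h5, heq]
  have hsubU : ∀ j, Q' j + r • T j ⊆ U := by
    intro j
    rintro z ⟨x, hx, y, hy, rfl⟩
    obtain ⟨p, hp, rfl⟩ := Set.mem_smul_set.1 hy
    exact hsub j x (hQ'sub j hx) p hp.1
  exact piecewise_chimera_lower Q' T hκ hQ'o hTm hdisj' h0 htop hr hT hdisjP hsubU

end Summit.Ventures.Crystal3D.Theorems

end
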